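import Summits.ABC.IUTFork.Conditional.HexDepthRadCore
import HarnessLib

/-!
# R-W lane P− «HEX-SHARP», RAD-UNIFORM core WITHOUT the hypothesis `l ≤ e`: the `a ≤ 1/3` form (`e ≥ 3`) and the
# trivial small-`e` form (`e ≤ 2`), with the decided table at `E(l) = 46080·l(l−1)²(l+1)`

PROOF-ONLY arithmetic sequel (D-0012; 0 definitions, 0 `Prop` facts) of `HexDepthRadCore` (p462893) by the same seat (abc-iut-W-num-6,
D-0079 R-W numerics crew). abc-iut-c312-7's interface `Conditional.GenuineK.exists_place_lamSeven` exports `7 ∤ e` and `e ≤ E(l)` at the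
deep place `x₀ | 7` but NOT `l ≤ e`, which `HexRad.logExponent_lt_floor_of_criterion` assumed (for `logRadiusA 7 e < 1/5 + 1/l`). This file
removes that assumption: for `e ≥ 3` one has `logRadiusA 7 e = ⌈e/5⌉/e ≤ 1/3` (`logRadiusA_seven_le_third`), and for `e ≤ 2` the turning index
is `0` and the inequality is trivial for `k ≥ 7`. The price in the table is one unit at `l = 41` (`k♯ = 30` instead of `29`); all other rows
keep `k♯(l) = 30, 29, 29, 29, 28, 29, 29, 29, ·, 30`. A datum wrapper feeds `HexRad.logExponent_lt_floor_of_criterion₃` (case `3 ≤ e`) or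
`HexRad.logExponent_lt_floor_small` (case `e ≤ 2`) into abc-iut-w5-d236's `GenuineK.not_pilotKummerCompatHull_chosen_of_star_envelope`
(p463434) / this seat's `Thm311.Real.…_of_realising_star_envelope` (p463492). TAKES NO SIDE on [IUTchIII] Cor. 3.12; arithmetic only. [folklore]
-/

noncomputable section

namespace Summit.ABC.IUTFork.Conditional

namespace HexRad

open Literature.IUT.LogVolume Literature.IUT.LogVolume.LogEnvelope

/-! ## §1. `a = ⌈e/5⌉/e ≤ 1/3` for `e ≥ 3` -/

/-- For `e ≥ 3`, [IUTchIV] Prop. 1.2's exponent at `p = 7` satisfies `logRadiusA 7 e = ⌈e/5⌉/e ≤ 1/3`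
(`⌈e/5⌉ ≤ ⌊e/3⌋`: `= 1 ≤ 1` for `e ∈ {3,4}`, and `e/5 ≤ (e−2)/3 ≤ ⌊e/3⌋` for `e ≥ 5`). [cite: Mochizuki2012, IUTchIV Prop. 1.2 p. 10] -/
theorem logRadiusA_seven_le_third {e : ℕ} (he : 3 ≤ e) : logRadiusA 7 e ≤ 1 / 3 := by
  have he0 : (0 : ℝ) < e := by exact_mod_cast (show 0 < e by omega)
  -- `e/5 ≤ (e/3 : ℕ)` as reals
  have hq : ((e : ℝ) / 5) ≤ ((e / 3 : ℕ) : ℝ) := by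
    have h3 : 3 * (e / 3) + 2 ≥ e := by omega
    have h3' : (3 : ℝ) * ((e / 3 : ℕ) : ℝ) + 2 ≥ e := by exact_mod_cast h3
    rcases Nat.lt_or_ge e 5 with hlt | hge
    · have h1 : 1 ≤ e / 3 := by omega
      have h1' : (1 : ℝ) ≤ ((e / 3 : ℕ) : ℝ) := by exact_mod_cast h1
      have he4 : (e : ℝ) ≤ 4 := by exact_mod_cast (show e ≤ 4 by omega)
      linarith
    · have hge' : (5 : ℝ) ≤ e := by exact_mod_cast hge
      linarith
  have h1 : ⌈(e : ℝ) / 5⌉ ≤ ((e / 3 : ℕ) : ℤ) := Int.ceil_le.mpr (by exact_mod_cast hq)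
  have hceil : ((⌈(e : ℝ) / 5⌉ : ℤ) : ℝ) ≤ ((e / 3 : ℕ) : ℝ) := by
    have h2 : ((⌈(e : ℝ) / 5⌉ : ℤ) : ℝ) ≤ (((e / 3 : ℕ) : ℤ) : ℝ) := by exact_mod_cast h1
    rw [Int.cast_natCast] at h2
    exact h2
  have hdiv : ((e / 3 : ℕ) : ℝ) ≤ (e : ℝ) / 3 := Nat.cast_div_le
  unfold logRadiusA
  rw [if_neg (by norm_num)]
  have h72 : (((7 : ℕ) : ℝ) - 2) = 5 := by norm_num
  rw [h72, div_le_iff₀ he0]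
  linarith

/-! ## §2. The core for `e ≥ 3` (no `l ≤ e`) -/

/-- **RAD-UNIFORM core, `e ≥ 3` form.** As `HexRad.logExponent_lt_floor_of_criterion` but with `3 ≤ e` in place of `l ≤ e` and the integer
`F` now satisfying `3l·F ≤ 3j²k − 3jl − (j+1)·l` (i.e. `F ≤ j²k/l − j − (j+1)/3`). [folklore] -/
theorem logExponent_lt_floor_of_criterion₃ (k l e E a₀ S : ℕ) (F : ℤ) (d : ℝ) (h11 : 11 ≤ l)
    (he3 : 3 ≤ e) (heE : e ≤ E) (hd : d < 1)
    (hlo : ∀ a < a₀, (7 : ℤ) ^ a * ((7 : ℤ) - 1) < e) (hhi : (e : ℤ) ≤ (7 : ℤ) ^ a₀ * ((7 : ℤ) - 1))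
    (hloS : ∀ a < S, (7 : ℤ) ^ a * ((7 : ℤ) - 1) < E) (hhiS : (E : ℤ) ≤ (7 : ℤ) ^ S * ((7 : ℤ) - 1))
    (hF : 3 * (l : ℤ) * F ≤ 3 * ((l - 1) / 2 : ℕ) ^ 2 * k - 3 * ((l - 1) / 2 : ℕ) * l - (((l - 1) / 2 : ℕ) + 1) * l)
    (hcrit : (((l - 1) / 2 : ℕ) + 1 : ℤ) * l * (S * E - 7 ^ S) < (F * l - k) * E) :
    (k : ℝ) / l + ((((l - 1) / 2 : ℕ) : ℝ) + 1) * ((a₀ : ℝ) - (7 : ℝ) ^ a₀ / e) <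
      ⌊((((l - 1) / 2 : ℕ) : ℝ)) ^ 2 * k / l - (((l - 1) / 2 : ℕ) : ℝ) * d
          - ((((l - 1) / 2 : ℕ) : ℝ) + 1) * logRadiusA 7 e⌋ := by
  haveI : Fact (Nat.Prime 7) := ⟨by norm_num⟩
  set j : ℕ := (l - 1) / 2 with hj
  have hl0 : (0 : ℝ) < l := by exact_mod_cast (show 0 < l by omega)
  have he1 : 1 ≤ e := le_trans (by norm_num) he3
  have he0 : (0 : ℝ) < e := by exact_mod_cast (show 0 < e by omega)
  have hE0 : (0 : ℝ) < E := by exact_mod_cast (show 0 < E by omega)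
  have hj0 : (0 : ℝ) ≤ (j : ℝ) := by positivity
  have hl0' : (l : ℝ) ≠ 0 := hl0.ne'
  have hE0' : (E : ℝ) ≠ 0 := hE0.ne'
  have hlo' : ∀ a < a₀, ((7 : ℕ) : ℤ) ^ a * (((7 : ℕ) : ℤ) - 1) < e := fun a ha => by exact_mod_cast hlo a ha
  have hhi' : (e : ℤ) ≤ ((7 : ℕ) : ℤ) ^ a₀ * (((7 : ℕ) : ℤ) - 1) := by exact_mod_cast hhi
  have hloS' : ∀ a < S, ((7 : ℕ) : ℤ) ^ a * (((7 : ℕ) : ℤ) - 1) < E := fun a ha => by exact_mod_cast hloS a ha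
  have hhiS' : (E : ℤ) ≤ ((7 : ℕ) : ℤ) ^ S * (((7 : ℕ) : ℤ) - 1) := by exact_mod_cast hhiS
  have henv : (a₀ : ℝ) - (7 : ℝ) ^ a₀ / e ≤ (S : ℝ) - (7 : ℝ) ^ S / E := by
    have h := envelope_logExponent_le_of_le (p := 7) he1 heE hlo' hhi' hloS' hhiS'
    exact_mod_cast h
  have ha : logRadiusA 7 e ≤ 1 / 3 := logRadiusA_seven_le_third he3
  have hFreal : (F : ℝ) ≤ (j : ℝ) ^ 2 * k / l - j - ((j : ℝ) + 1) / 3 := by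
    have h' : (3 * (l : ℤ) * F : ℝ) ≤ ((3 * j ^ 2 * k - 3 * j * l - (j + 1) * l : ℤ) : ℝ) := by
      exact_mod_cast hF
    push_cast at h'
    rw [show (j : ℝ) ^ 2 * k / l - j - ((j : ℝ) + 1) / 3
        = ((3 : ℝ) * j ^ 2 * k - 3 * j * l - (j + 1) * l) / (3 * l) by
          field_simp]
    rw [le_div_iff₀ (by positivity)]
    have hcomm : (F : ℝ) * (3 * l) = 3 * l * F := by ring
    rw [hcomm]
    linarith
  have hFle : (F : ℝ) ≤ (j : ℝ) ^ 2 * k / l - (j : ℝ) * d - ((j : ℝ) + 1) * logRadiusA 7 e := by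
    have h1 : (j : ℝ) * d ≤ j := by nlinarith
    have h2 : ((j : ℝ) + 1) * logRadiusA 7 e ≤ ((j : ℝ) + 1) * (1 / 3) :=
      mul_le_mul_of_nonneg_left ha (by positivity)
    have h3 : ((j : ℝ) + 1) * (1 / 3 : ℝ) = ((j : ℝ) + 1) / 3 := by ring
    linarith
  have hFfloor : F ≤ ⌊(j : ℝ) ^ 2 * k / l - (j : ℝ) * d - ((j : ℝ) + 1) * logRadiusA 7 e⌋ := Int.le_floor.mpr hFle
  have hFfloorR : (F : ℝ) ≤ (⌊(j : ℝ) ^ 2 * k / l - (j : ℝ) * d - ((j : ℝ) + 1) * logRadiusA 7 e⌋ : ℝ) := by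
    exact_mod_cast hFfloor
  have hcritR : (k : ℝ) / l + ((j : ℝ) + 1) * ((S : ℝ) - (7 : ℝ) ^ S / E) < F := by
    have h' : (((j + 1 : ℤ) * l * (S * E - 7 ^ S) : ℤ) : ℝ) < (((F * l - k) * E : ℤ) : ℝ) := by exact_mod_cast hcrit
    push_cast at h'
    have hlE : (0 : ℝ) < (l : ℝ) * E := mul_pos hl0 hE0
    rw [show (k : ℝ) / l + ((j : ℝ) + 1) * ((S : ℝ) - (7 : ℝ) ^ S / E)
        = ((k : ℝ) * E + ((j : ℝ) + 1) * l * (S * E - 7 ^ S)) / (l * E) by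
          field_simp]
    rw [div_lt_iff₀ hlE]
    have hcomm : (F : ℝ) * (l * E) = (F * l - k) * E + k * E := by ring
    rw [hcomm]
    linarith
  have hstep : ((j : ℝ) + 1) * ((a₀ : ℝ) - (7 : ℝ) ^ a₀ / e) ≤ ((j : ℝ) + 1) * ((S : ℝ) - (7 : ℝ) ^ S / E) :=
    mul_le_mul_of_nonneg_left henv (by positivity)
  linarith

/-! ## §3. The trivial small-`e` form (`e ≤ 2`: turning index `0`) -/

/-- **RAD-UNIFORM core, `e ≤ 2`.** Then the turning index is `0`, the envelope term is `−(j+1)/e < 0`, and for `k ≥ 7`, `l ≥ 11` the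
inequality holds outright (uses only `d < 1` and `logRadiusA 7 e < 1/5 + 1/e ≤ 6/5`). [folklore] -/
theorem logExponent_lt_floor_small (k l e a₀ : ℕ) (d : ℝ) (h11 : 11 ≤ l) (hodd : l % 2 = 1) (hk7 : 7 ≤ k) (he1 : 1 ≤ e) (he2 : e ≤ 2) (hd : d < 1)
    (hlo : ∀ a < a₀, (7 : ℤ) ^ a * ((7 : ℤ) - 1) < e) :
    (k : ℝ) / l + ((((l - 1) / 2 : ℕ) : ℝ) + 1) * ((a₀ : ℝ) - (7 : ℝ) ^ a₀ / e) <
      ⌊((((l - 1) / 2 : ℕ) : ℝ)) ^ 2 * k / l - (((l - 1) / 2 : ℕ) : ℝ) * d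
          - ((((l - 1) / 2 : ℕ) : ℝ) + 1) * logRadiusA 7 e⌋ := by
  haveI : Fact (Nat.Prime 7) := ⟨by norm_num⟩
  have hj5 : 5 ≤ (l - 1) / 2 := by omega
  have hjl : l ≤ 2 * ((l - 1) / 2) + 1 := by omega
  set j : ℕ := (l - 1) / 2 with hj
  have hl0 : (0 : ℝ) < l := by exact_mod_cast (show 0 < l by omega)
  have hl0' : (l : ℝ) ≠ 0 := hl0.ne'
  have he0 : (0 : ℝ) < e := by exact_mod_cast (show 0 < e by omega)
  have hj0 : (0 : ℝ) ≤ (j : ℝ) := by positivity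
  -- the turning index is `0`
  have ha0 : a₀ = 0 := by
    by_contra h
    have h0 : 0 < a₀ := Nat.pos_of_ne_zero h
    have h6 := hlo 0 h0
    have he2' : (e : ℤ) ≤ 2 := by exact_mod_cast he2
    simp at h6
    omega
  subst ha0
  -- `a < 6/5`
  have ha1 : logRadiusA 7 e ≤ 6 / 5 := by
    have h := logRadiusA_lt_inv_add_inv (p := 7) (by norm_num) he1
    have h5 : (1 : ℝ) / (((7 : ℕ) : ℝ) - 2) = 1 / 5 := by norm_num
    rw [h5] at h
    have hinv : 1 / (e : ℝ) ≤ 1 := by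
      rw [div_le_one he0]
      exact_mod_cast he1
    linarith
  -- floor lower bound
  have hfl : (j : ℝ) ^ 2 * k / l - j - 6 / 5 * ((j : ℝ) + 1) - 1 <
      (⌊(j : ℝ) ^ 2 * k / l - (j : ℝ) * d - ((j : ℝ) + 1) * logRadiusA 7 e⌋ : ℝ) := by
    have h1 : (j : ℝ) * d ≤ j := by nlinarith
    have h2 : ((j : ℝ) + 1) * logRadiusA 7 e ≤ ((j : ℝ) + 1) * (6 / 5) :=
      mul_le_mul_of_nonneg_left ha1 (by positivity)
    have h3 := Int.sub_one_lt_floor ((j : ℝ) ^ 2 * k / l - (j : ℝ) * d - ((j : ℝ) + 1) * logRadiusA 7 e)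
    linarith
  -- the envelope term is `≤ 0`
  have henv : ((j : ℝ) + 1) * (((0 : ℕ) : ℝ) - (7 : ℝ) ^ (0 : ℕ) / e) ≤ 0 := by
    have h1 : (0 : ℝ) ≤ (7 : ℝ) ^ (0 : ℕ) / e := by positivity
    have h2 : ((0 : ℕ) : ℝ) - (7 : ℝ) ^ (0 : ℕ) / e ≤ 0 := by push_cast; linarith
    exact mul_nonpos_of_nonneg_of_nonpos (by positivity) h2
  -- main: `k/l + j + (6/5)(j+1) + 1 ≤ j² k / l` from `k ≥ 7`, `l ≤ 2j+1`, `j ≥ 5`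
  have hmain : (k : ℝ) / l + j + 6 / 5 * ((j : ℝ) + 1) + 1 ≤ (j : ℝ) ^ 2 * k / l := by
    have hjl' : (l : ℝ) ≤ 2 * j + 1 := by exact_mod_cast hjl
    have hk7' : (7 : ℝ) ≤ k := by exact_mod_cast hk7
    have hj5' : (5 : ℝ) ≤ j := by exact_mod_cast hj5
    -- clear the denominator
    have key : (k : ℝ) + ((j : ℝ) + 6 / 5 * ((j : ℝ) + 1) + 1) * l ≤ (j : ℝ) ^ 2 * k := by
      have hc : (0 : ℝ) ≤ (j : ℝ) + 6 / 5 * ((j : ℝ) + 1) + 1 := by positivity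
      have h1 : ((j : ℝ) + 6 / 5 * ((j : ℝ) + 1) + 1) * l ≤ ((j : ℝ) + 6 / 5 * ((j : ℝ) + 1) + 1) * (2 * j + 1) :=
        mul_le_mul_of_nonneg_left hjl' hc
      have h2 : (0 : ℝ) ≤ ((k : ℝ) - 7) * ((j : ℝ) ^ 2 - 1) :=
        mul_nonneg (by linarith) (by nlinarith)
      nlinarith
    have hdiv := div_le_div_of_nonneg_right key hl0.le
    have hsplit : ((k : ℝ) + ((j : ℝ) + 6 / 5 * ((j : ℝ) + 1) + 1) * l) / l
        = (k : ℝ) / l + j + 6 / 5 * ((j : ℝ) + 1) + 1 := by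
      field_simp
      ring
    rw [hsplit] at hdiv
    exact hdiv
  linarith

/-! ## §4. Monotonicity and the decided table for the `e ≥ 3` form -/

/-- The `e ≥ 3` criterion climbs in `k` (`F ↦ F + 2`; `3j² ≥ 6l` for `l ≥ 11`). [folklore] -/
theorem criterion₃_succ {k l E S : ℕ} {F : ℤ} (h11 : 11 ≤ l)
    (hF : 3 * (l : ℤ) * F ≤ 3 * ((l - 1) / 2 : ℕ) ^ 2 * k - 3 * ((l - 1) / 2 : ℕ) * l - (((l - 1) / 2 : ℕ) + 1) * l)
    (hcrit : (((l - 1) / 2 : ℕ) + 1 : ℤ) * l * (S * E - 7 ^ S) < (F * l - k) * E) :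
    3 * (l : ℤ) * (F + 2) ≤ 3 * ((l - 1) / 2 : ℕ) ^ 2 * (k + 1 : ℕ) - 3 * ((l - 1) / 2 : ℕ) * l
        - (((l - 1) / 2 : ℕ) + 1) * l ∧
      (((l - 1) / 2 : ℕ) + 1 : ℤ) * l * (S * E - 7 ^ S) < ((F + 2) * l - (k + 1 : ℕ)) * E := by
  have hj5 : 5 ≤ (l - 1) / 2 := by omega
  have hj2 : 2 * (l : ℤ) ≤ (((l - 1) / 2 : ℕ) : ℤ) ^ 2 := by
    have h5 : 5 * ((l - 1) / 2) ≤ ((l - 1) / 2) * ((l - 1) / 2) := Nat.mul_le_mul_right _ hj5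
    have h : 2 * l ≤ ((l - 1) / 2) ^ 2 := by rw [sq]; omega
    exact_mod_cast h
  refine ⟨?_, ?_⟩
  · have e1 : 3 * (l : ℤ) * (F + 2) = 3 * (l : ℤ) * F + 6 * l := by ring
    have e2 : 3 * (((l - 1) / 2 : ℕ) : ℤ) ^ 2 * ((k + 1 : ℕ) : ℤ)
        = 3 * (((l - 1) / 2 : ℕ) : ℤ) ^ 2 * (k : ℤ) + 3 * (((l - 1) / 2 : ℕ) : ℤ) ^ 2 := by
      push_cast; ring
    rw [e1, e2]
    linarith
  · have hE : (0 : ℤ) ≤ E := by positivity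
    have e3 : ((F + 2) * (l : ℤ) - ((k + 1 : ℕ) : ℤ)) = (F * l - k) + (2 * l - 1) := by push_cast; ring
    have hle : (F * l - k) * (E : ℤ) ≤ ((F + 2) * l - ((k + 1 : ℕ) : ℤ)) * E := by
      rw [e3]
      apply mul_le_mul_of_nonneg_right _ hE
      have hl : (0 : ℤ) ≤ l := by positivity
      linarith
    exact lt_of_lt_of_le hcrit hle

/-- Every `k ≥ k₀` from one certified row of the `e ≥ 3` criterion. [folklore] -/
theorem criterion₃_of_le {k₀ l E S : ℕ} {F₀ : ℤ} (h11 : 11 ≤ l)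
    (hF : 3 * (l : ℤ) * F₀ ≤ 3 * ((l - 1) / 2 : ℕ) ^ 2 * k₀ - 3 * ((l - 1) / 2 : ℕ) * l - (((l - 1) / 2 : ℕ) + 1) * l)
    (hcrit : (((l - 1) / 2 : ℕ) + 1 : ℤ) * l * (S * E - 7 ^ S) < (F₀ * l - k₀) * E) {k : ℕ} (hk : k₀ ≤ k) :
    ∃ F : ℤ, 3 * (l : ℤ) * F ≤ 3 * ((l - 1) / 2 : ℕ) ^ 2 * k - 3 * ((l - 1) / 2 : ℕ) * l - (((l - 1) / 2 : ℕ) + 1) * l ∧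
      (((l - 1) / 2 : ℕ) + 1 : ℤ) * l * (S * E - 7 ^ S) < (F * l - k) * E := by
  induction k, hk using Nat.le_induction with
  | base => exact ⟨F₀, hF, hcrit⟩
  | succ n hn ih =>
    obtain ⟨F, h1, h2⟩ := ih
    exact ⟨F + 2, criterion₃_succ h11 h1 h2⟩

/-- **Row `l = 11` (`e ≥ 3` form): every `k ≥ k♯ = 30`** satisfies the criterion at `E(11)`, `S = 10` (first row `F₀ = 61`). [folklore] -/
theorem criterion₃_of_le_11 {k : ℕ} (hk : 30 ≤ k) :
    ∃ F : ℤ, 3 * ((11 : ℕ) : ℤ) * F ≤ 3 * ((11 - 1) / 2 : ℕ) ^ 2 * k - 3 * ((11 - 1) / 2 : ℕ) * ((11 : ℕ) : ℤ) - (((11 - 1) / 2 : ℕ) + 1) * ((11 : ℕ) : ℤ) ∧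
      ((((11 - 1) / 2 : ℕ) + 1 : ℤ) * ((11 : ℕ) : ℤ) * (((10 : ℕ) : ℤ) * ((46080 * (11 * (11 - 1) ^ 2 * (11 + 1)) : ℕ) : ℤ) - 7 ^ (10 : ℕ))) < (F * ((11 : ℕ) : ℤ) - k) * ((46080 * (11 * (11 - 1) ^ 2 * (11 + 1)) : ℕ) : ℤ) :=
  @criterion₃_of_le 30 11 (46080 * (11 * (11 - 1) ^ 2 * (11 + 1))) 10 61 (by norm_num) (by norm_num) (by norm_num) k hk

/-- **Row `l = 13` (`e ≥ 3` form): every `k ≥ k♯ = 29`** satisfies the criterion at `E(13)`, `S = 10` (first row `F₀ = 71`). [folklore] -/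
theorem criterion₃_of_le_13 {k : ℕ} (hk : 29 ≤ k) :
    ∃ F : ℤ, 3 * ((13 : ℕ) : ℤ) * F ≤ 3 * ((13 - 1) / 2 : ℕ) ^ 2 * k - 3 * ((13 - 1) / 2 : ℕ) * ((13 : ℕ) : ℤ) - (((13 - 1) / 2 : ℕ) + 1) * ((13 : ℕ) : ℤ) ∧
      ((((13 - 1) / 2 : ℕ) + 1 : ℤ) * ((13 : ℕ) : ℤ) * (((10 : ℕ) : ℤ) * ((46080 * (13 * (13 - 1) ^ 2 * (13 + 1)) : ℕ) : ℤ) - 7 ^ (10 : ℕ))) < (F * ((13 : ℕ) : ℤ) - k) * ((46080 * (13 * (13 - 1) ^ 2 * (13 + 1)) : ℕ) : ℤ) :=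
  @criterion₃_of_le 29 13 (46080 * (13 * (13 - 1) ^ 2 * (13 + 1))) 10 71 (by norm_num) (by norm_num) (by norm_num) k hk

/-- **Row `l = 17` (`e ≥ 3` form): every `k ≥ k♯ = 29`** satisfies the criterion at `E(17)`, `S = 11` (first row `F₀ = 98`). [folklore] -/
theorem criterion₃_of_le_17 {k : ℕ} (hk : 29 ≤ k) :
    ∃ F : ℤ, 3 * ((17 : ℕ) : ℤ) * F ≤ 3 * ((17 - 1) / 2 : ℕ) ^ 2 * k - 3 * ((17 - 1) / 2 : ℕ) * ((17 : ℕ) : ℤ) - (((17 - 1) / 2 : ℕ) + 1) * ((17 : ℕ) : ℤ) ∧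
      ((((17 - 1) / 2 : ℕ) + 1 : ℤ) * ((17 : ℕ) : ℤ) * (((11 : ℕ) : ℤ) * ((46080 * (17 * (17 - 1) ^ 2 * (17 + 1)) : ℕ) : ℤ) - 7 ^ (11 : ℕ))) < (F * ((17 : ℕ) : ℤ) - k) * ((46080 * (17 * (17 - 1) ^ 2 * (17 + 1)) : ℕ) : ℤ) :=
  @criterion₃_of_le 29 17 (46080 * (17 * (17 - 1) ^ 2 * (17 + 1))) 11 98 (by norm_num) (by norm_num) (by norm_num) k hk

/-- **Row `l = 19` (`e ≥ 3` form): every `k ≥ k♯ = 29`** satisfies the criterion at `E(19)`, `S = 11` (first row `F₀ = 111`). [folklore] -/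
theorem criterion₃_of_le_19 {k : ℕ} (hk : 29 ≤ k) :
    ∃ F : ℤ, 3 * ((19 : ℕ) : ℤ) * F ≤ 3 * ((19 - 1) / 2 : ℕ) ^ 2 * k - 3 * ((19 - 1) / 2 : ℕ) * ((19 : ℕ) : ℤ) - (((19 - 1) / 2 : ℕ) + 1) * ((19 : ℕ) : ℤ) ∧
      ((((19 - 1) / 2 : ℕ) + 1 : ℤ) * ((19 : ℕ) : ℤ) * (((11 : ℕ) : ℤ) * ((46080 * (19 * (19 - 1) ^ 2 * (19 + 1)) : ℕ) : ℤ) - 7 ^ (11 : ℕ))) < (F * ((19 : ℕ) : ℤ) - k) * ((46080 * (19 * (19 - 1) ^ 2 * (19 + 1)) : ℕ) : ℤ) :=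
  @criterion₃_of_le 29 19 (46080 * (19 * (19 - 1) ^ 2 * (19 + 1))) 11 111 (by norm_num) (by norm_num) (by norm_num) k hk

/-- **Row `l = 23` (`e ≥ 3` form): every `k ≥ k♯ = 28`** satisfies the criterion at `E(23)`, `S = 12` (first row `F₀ = 132`). [folklore] -/
theorem criterion₃_of_le_23 {k : ℕ} (hk : 28 ≤ k) :
    ∃ F : ℤ, 3 * ((23 : ℕ) : ℤ) * F ≤ 3 * ((23 - 1) / 2 : ℕ) ^ 2 * k - 3 * ((23 - 1) / 2 : ℕ) * ((23 : ℕ) : ℤ) - (((23 - 1) / 2 : ℕ) + 1) * ((23 : ℕ) : ℤ) ∧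
      ((((23 - 1) / 2 : ℕ) + 1 : ℤ) * ((23 : ℕ) : ℤ) * (((12 : ℕ) : ℤ) * ((46080 * (23 * (23 - 1) ^ 2 * (23 + 1)) : ℕ) : ℤ) - 7 ^ (12 : ℕ))) < (F * ((23 : ℕ) : ℤ) - k) * ((46080 * (23 * (23 - 1) ^ 2 * (23 + 1)) : ℕ) : ℤ) :=
  @criterion₃_of_le 28 23 (46080 * (23 * (23 - 1) ^ 2 * (23 + 1))) 12 132 (by norm_num) (by norm_num) (by norm_num) k hk

/-- **Row `l = 29` (`e ≥ 3` form): every `k ≥ k♯ = 29`** satisfies the criterion at `E(29)`, `S = 12` (first row `F₀ = 177`). [folklore] -/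
theorem criterion₃_of_le_29 {k : ℕ} (hk : 29 ≤ k) :
    ∃ F : ℤ, 3 * ((29 : ℕ) : ℤ) * F ≤ 3 * ((29 - 1) / 2 : ℕ) ^ 2 * k - 3 * ((29 - 1) / 2 : ℕ) * ((29 : ℕ) : ℤ) - (((29 - 1) / 2 : ℕ) + 1) * ((29 : ℕ) : ℤ) ∧
      ((((29 - 1) / 2 : ℕ) + 1 : ℤ) * ((29 : ℕ) : ℤ) * (((12 : ℕ) : ℤ) * ((46080 * (29 * (29 - 1) ^ 2 * (29 + 1)) : ℕ) : ℤ) - 7 ^ (12 : ℕ))) < (F * ((29 : ℕ) : ℤ) - k) * ((46080 * (29 * (29 - 1) ^ 2 * (29 + 1)) : ℕ) : ℤ) :=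
  @criterion₃_of_le 29 29 (46080 * (29 * (29 - 1) ^ 2 * (29 + 1))) 12 177 (by norm_num) (by norm_num) (by norm_num) k hk

/-- **Row `l = 31` (`e ≥ 3` form): every `k ≥ k♯ = 29`** satisfies the criterion at `E(31)`, `S = 12` (first row `F₀ = 190`). [folklore] -/
theorem criterion₃_of_le_31 {k : ℕ} (hk : 29 ≤ k) :
    ∃ F : ℤ, 3 * ((31 : ℕ) : ℤ) * F ≤ 3 * ((31 - 1) / 2 : ℕ) ^ 2 * k - 3 * ((31 - 1) / 2 : ℕ) * ((31 : ℕ) : ℤ) - (((31 - 1) / 2 : ℕ) + 1) * ((31 : ℕ) : ℤ) ∧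
      ((((31 - 1) / 2 : ℕ) + 1 : ℤ) * ((31 : ℕ) : ℤ) * (((12 : ℕ) : ℤ) * ((46080 * (31 * (31 - 1) ^ 2 * (31 + 1)) : ℕ) : ℤ) - 7 ^ (12 : ℕ))) < (F * ((31 : ℕ) : ℤ) - k) * ((46080 * (31 * (31 - 1) ^ 2 * (31 + 1)) : ℕ) : ℤ) :=
  @criterion₃_of_le 29 31 (46080 * (31 * (31 - 1) ^ 2 * (31 + 1))) 12 190 (by norm_num) (by norm_num) (by norm_num) k hk

/-- **Row `l = 37` (`e ≥ 3` form): every `k ≥ k♯ = 29`** satisfies the criterion at `E(37)`, `S = 13` (first row `F₀ = 229`). [folklore] -/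
theorem criterion₃_of_le_37 {k : ℕ} (hk : 29 ≤ k) :
    ∃ F : ℤ, 3 * ((37 : ℕ) : ℤ) * F ≤ 3 * ((37 - 1) / 2 : ℕ) ^ 2 * k - 3 * ((37 - 1) / 2 : ℕ) * ((37 : ℕ) : ℤ) - (((37 - 1) / 2 : ℕ) + 1) * ((37 : ℕ) : ℤ) ∧
      ((((37 - 1) / 2 : ℕ) + 1 : ℤ) * ((37 : ℕ) : ℤ) * (((13 : ℕ) : ℤ) * ((46080 * (37 * (37 - 1) ^ 2 * (37 + 1)) : ℕ) : ℤ) - 7 ^ (13 : ℕ))) < (F * ((37 : ℕ) : ℤ) - k) * ((46080 * (37 * (37 - 1) ^ 2 * (37 + 1)) : ℕ) : ℤ) :=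
  @criterion₃_of_le 29 37 (46080 * (37 * (37 - 1) ^ 2 * (37 + 1))) 13 229 (by norm_num) (by norm_num) (by norm_num) k hk

/-- **Row `l = 41` (`e ≥ 3` form): every `k ≥ k♯ = 30`** satisfies the criterion at `E(41)`, `S = 13` (first row `F₀ = 265`). [folklore] -/
theorem criterion₃_of_le_41 {k : ℕ} (hk : 30 ≤ k) :
    ∃ F : ℤ, 3 * ((41 : ℕ) : ℤ) * F ≤ 3 * ((41 - 1) / 2 : ℕ) ^ 2 * k - 3 * ((41 - 1) / 2 : ℕ) * ((41 : ℕ) : ℤ) - (((41 - 1) / 2 : ℕ) + 1) * ((41 : ℕ) : ℤ) ∧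
      ((((41 - 1) / 2 : ℕ) + 1 : ℤ) * ((41 : ℕ) : ℤ) * (((13 : ℕ) : ℤ) * ((46080 * (41 * (41 - 1) ^ 2 * (41 + 1)) : ℕ) : ℤ) - 7 ^ (13 : ℕ))) < (F * ((41 : ℕ) : ℤ) - k) * ((46080 * (41 * (41 - 1) ^ 2 * (41 + 1)) : ℕ) : ℤ) :=
  @criterion₃_of_le 30 41 (46080 * (41 * (41 - 1) ^ 2 * (41 + 1))) 13 265 (by norm_num) (by norm_num) (by norm_num) k hk

/-- **Row `l = 43` (`e ≥ 3` form): every `k ≥ k♯ = 30`** satisfies the criterion at `E(43)`, `S = 13` (first row `F₀ = 279`). [folklore] -/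
theorem criterion₃_of_le_43 {k : ℕ} (hk : 30 ≤ k) :
    ∃ F : ℤ, 3 * ((43 : ℕ) : ℤ) * F ≤ 3 * ((43 - 1) / 2 : ℕ) ^ 2 * k - 3 * ((43 - 1) / 2 : ℕ) * ((43 : ℕ) : ℤ) - (((43 - 1) / 2 : ℕ) + 1) * ((43 : ℕ) : ℤ) ∧
      ((((43 - 1) / 2 : ℕ) + 1 : ℤ) * ((43 : ℕ) : ℤ) * (((13 : ℕ) : ℤ) * ((46080 * (43 * (43 - 1) ^ 2 * (43 + 1)) : ℕ) : ℤ) - 7 ^ (13 : ℕ))) < (F * ((43 : ℕ) : ℤ) - k) * ((46080 * (43 * (43 - 1) ^ 2 * (43 + 1)) : ℕ) : ℤ) :=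
  @criterion₃_of_le 30 43 (46080 * (43 * (43 - 1) ^ 2 * (43 + 1))) 13 279 (by norm_num) (by norm_num) (by norm_num) k hk

end HexRad

end Summit.ABC.IUTFork.Conditional

end
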